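import Mathlib
import Summits.ResolutionOfSingularities.ResolutionOfSingularities.Theorems.RadicialJungCleanModelsPointCentreStepOfBase
import Summits.ResolutionOfSingularities.ResolutionOfSingularities.Theorems.RadicialJungCleanModelsCleanPermissibleTransport
import Summits.ResolutionOfSingularities.ResolutionOfSingularities.Theorems.MarkedTransferCampaignW46ThreefoldsGammaFreeGlobalPatchingFinite
import Summits.ResolutionOfSingularities.ResolutionOfSingularities.Theorems.RadicialJungCleanModelsModelOfOpenImmersion
import Summits.ResolutionOfSingularities.ResolutionOfSingularities.Theorems.PAlterationPicoverFunctionFieldNormalizationIn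
import Literature.AlgebraicGeometry.Resolution.RegularCentreComponents
import HarnessLib

/-!
# Route `RadicialJung`, crux `CleanModels` (stmt-ResolutionOfSingularities-15917), line `Sketch` rev 35, stub 6 `stub_cleanProp44` (X44c):
# CLEAN PATCHING I — clean-permissible sequences restrict along open immersions

Work item (W1) «clean patching» of the memo `Cruxes/CleanModels/Lines/Sketch-memo-4e-cleanPermissible.md` §7 (clean twins of the W4.6
patching files `MarkedTransferCampaignW46ThreefoldsGammaFreeGlobal{Local,Etale,Patching,PatchingFinite}.lean` for the output currency
`IsCleanPermissibleSeq` of X44c).  This first file is the clean twin of the étale transport `CampaignW46.OrderReducible.comap_of_etale`,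
for OPEN IMMERSIONS (the function field must not change, since the line of `G` lives in it):

* `CleanPermissibleAt.of_functionFieldMap_of_isIso_stalkMap` — DESCENT of clean-permissibility along a dominant morphism of integral schemes
  with an isomorphic stalk and a bijective function-field map (companion of the landed ascent ✓ `CleanPermissibleAt.functionFieldMap_of_isIso_stalkMap`).
* `isRegular_subscheme_comap_of_isOpenImmersion` — a regular closed subscheme restricts to a regular closed subscheme of an open subscheme;
  `isIrreducible_of_isIntegral_subscheme_vanishingIdeal` — the support of an integral reduced closed subscheme is irreducible
  (open immersions of integral schemes are dominant: ✓ `isDominant_of_isOpenImmersion`, `…ModelOfOpenImmersion.lean`).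
* `IsCleanPermissibleSeq.exists_restrict_of_isOpenImmersion` — **a clean-permissible sequence `π : V' → V` for `(J, μ, G)` restricts along an
  open immersion `e : W → V` of integral schemes to a clean-permissible sequence `π_W : W' → W` for `(e^*J, μ, e^♯ G)`** with an open immersion
  `e' : W' → V'`, `e' ≫ π = π_W ≫ e`, and last transform `e'^* J'` (each centre is restricted to `W`; where the restriction is empty the stage
  is unchanged and `e'` is lifted through the blowing up, an isomorphism off its centre; blowing ups commute with open immersions
  ✓ `IsBlowup.isPullback_of_isOpenImmersion`, controlled transforms with flat base change ✓ `comap_controlledTransform_of_flat`).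
* `exists_isCleanPermissibleSeq_lt_of_isOpenImmersion` — hence the conclusion of X44c («some clean-permissible sequence brings the order
  below `μ`») passes from `V` to every open `W ↪ V`.

Honest framing: OURS (glue, any dimension); nothing here proves X44c, any case of `CleanModels`, or resolution of singularities in characteristic `p`.
-/

noncomputable section

set_option linter.dupNamespace false -- mandated namespace of this single-conjunct summit

open CategoryTheory CategoryTheory.Limits AlgebraicGeometry TopologicalSpace IsLocalRing
open Literature.AlgebraicGeometry.Resolution Literature.AlgebraicGeometry.Motives
open Scheme.IdealSheafData

namespace Summit.ResolutionOfSingularities.ResolutionOfSingularities.Theorems.RadicialJung.CleanModels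

/-! ## Descent of clean-permissibility along a local isomorphism -/

/-- **Clean-permissibility descends along a local isomorphism of integral schemes with the same function field**: if `f : X → Y` is
dominant with bijective `f^♯ : K(Y) → K(X)`, its stalk map at `x` is an isomorphism, and the line of `f^♯ G` is clean-permissible at `x` for
the stalk of `J𝒪_X = J.comap f`, then the line of `G` is clean-permissible at `f x` for the stalk of `J` (inverse of
✓ `CleanPermissibleAt.functionFieldMap_of_isIso_stalkMap`; the way a centre found on an open chart is read on the ambient stage). [folklore] -/
theorem CleanPermissibleAt.of_functionFieldMap_of_isIso_stalkMap {p : ℕ} {X Y : Scheme.{0}} [IsIntegral X] [IsIntegral Y]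
    (f : X ⟶ Y) [IsDominant f] (hf : Function.Bijective (RatFn.functionFieldMap f)) (x : X) [IsIso (f.stalkMap x)]
    {G : Y.functionField} (J : Y.IdealSheafData)
    (h : CleanPermissibleAt p (algebraMap (X.presheaf.stalk x) X.functionField) (RatFn.functionFieldMap f G)
      (stalkIdeal (J.comap f) x)) :
    CleanPermissibleAt p (algebraMap (Y.presheaf.stalk (f x)) Y.functionField) G (stalkIdeal J (f x)) := by
  let φ : Y.functionField ≃+* X.functionField := RingEquiv.ofBijective (RatFn.functionFieldMap f) hf
  let e : Y.presheaf.stalk (f x) ≃+* X.presheaf.stalk x := (asIso (f.stalkMap x)).commRingCatIsoToRingEquiv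
  have h1 := h.map (φ.symm : X.functionField →+* Y.functionField) φ.symm.injective
  have hφG : (φ.symm : X.functionField →+* Y.functionField) (RatFn.functionFieldMap f G) = G :=
    φ.symm_apply_apply G
  rw [hφG] at h1
  have h2 := h1.of_ringEquiv e.symm (f' := algebraMap (Y.presheaf.stalk (f x)) Y.functionField) fun t => by
    obtain ⟨s, rfl⟩ : ∃ s, t = e s := ⟨e.symm t, (e.apply_symm_apply t).symm⟩
    rw [e.symm_apply_apply]
    apply φ.injective
    change RatFn.functionFieldMap f (RatFn.toFunctionField (f x) s) =
      φ (φ.symm (algebraMap (X.presheaf.stalk x) X.functionField ((f.stalkMap x) s)))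
    rw [φ.apply_symm_apply, RatFn.functionFieldMap_toFunctionField]
  have hI : (stalkIdeal (J.comap f) x).map (e.symm : X.presheaf.stalk x →+* Y.presheaf.stalk (f x)) =
      stalkIdeal J (f x) := by
    rw [stalkIdeal_comap_eq_map_stalkMap f J x, Ideal.map_map]
    have hcomp : (e.symm : X.presheaf.stalk x →+* Y.presheaf.stalk (f x)).comp (f.stalkMap x).hom =
        RingHom.id _ := by
      ext s
      exact e.symm_apply_apply s
    rw [hcomp, Ideal.map_id]
  rwa [hI] at h2

/-! ## Regular / integral closed subschemes and open immersions -/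

/-- **A regular closed subscheme restricts to a regular closed subscheme of an open subscheme** (the quotient stalks agree along the stalk
isomorphisms of the open immersion; converse direction of ✓ `CampaignW46.isRegular_subscheme_of_support_subset_range`). [folklore] -/
theorem isRegular_subscheme_comap_of_isOpenImmersion {W V : Scheme.{0}} [IsLocallyNoetherian V] [IsLocallyNoetherian W]
    (e : W ⟶ V) [IsOpenImmersion e] (C : V.IdealSheafData) (hreg : Scheme.IsRegular C.subscheme) :
    Scheme.IsRegular (C.comap e).subscheme := by
  refine Scheme.isRegular_subscheme_of_forall (C.comap e) fun w hw => ?_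
  have hw' : e w ∈ C.support := by rw [support_comap] at hw; exact hw
  have hq := (Scheme.isRegular_subscheme_iff C).mp hreg (e w) hw'
  haveI : IsIso (e.stalkMap w) := (IsOpenImmersion.iff_isIso_stalkMap.mp inferInstance).2 w
  let ε : V.presheaf.stalk (e w) ≃+* W.presheaf.stalk w := (asIso (e.stalkMap w)).commRingCatIsoToRingEquiv
  have hmap : stalkIdeal (C.comap e) w = (stalkIdeal C (e w)).map (ε : _ →+* _) :=
    stalkIdeal_comap_eq_map_stalkMap e C w
  exact IsRegularLocalRing.of_ringEquiv (Ideal.quotientEquiv _ _ ε hmap)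

/-- The support of an integral reduced closed subscheme is irreducible. [folklore] -/
theorem isIrreducible_of_isIntegral_subscheme_vanishingIdeal {V : Scheme.{0}} (Y : Closeds V)
    (h : IsIntegral (vanishingIdeal Y).subscheme) : IsIrreducible (Y : Set V) := by
  have h1 : IsIrreducible (Set.range (vanishingIdeal Y).subschemeι) := by
    rw [← Set.image_univ]
    exact (IrreducibleSpace.isIrreducible_univ _).image _ (vanishingIdeal Y).subschemeι.continuous.continuousOn
  rwa [range_subschemeι, Scheme.IdealSheafData.coe_support_vanishingIdeal] at h1

/-- The zero ideal sheaf of a non-empty integral scheme is not an effective Cartier divisor (a local generator would be `0`, a zero-divisor of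
the non-trivial ring of sections of an affine open containing a point). [cite: GortzWedhorn2020, (13.19) p. 413] -/
theorem not_isEffectiveCartier_bot_of_isIntegral {E : Scheme.{0}} [IsIntegral E] : ¬ IsEffectiveCartier (⊥ : E.IdealSheafData) := by
  intro h
  obtain ⟨x⟩ := (inferInstance : Nonempty E)
  obtain ⟨U, hxU, f, hf, hfU⟩ := h x
  haveI : Nonempty (U : E.Opens) := ⟨⟨x, hxU⟩⟩
  rw [Scheme.IdealSheafData.ideal_bot, Pi.bot_apply, eq_comm, Ideal.span_singleton_eq_bot] at hfU
  rw [hfU] at hf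
  exact zero_notMem_nonZeroDivisors hf

/-! ## Restriction of a clean-permissible sequence along an open immersion -/

/-- **Clean-permissible sequences restrict along open immersions.**  Let `π : V' → V` be a clean-permissible sequence for `(J, μ)` and the
line of `G` (`IsCleanPermissibleSeq p π J μ J' G`) on a locally Noetherian integral `V`, and `e : W → V` an open immersion from an integral
`W` (so `e` is dominant).  Then there are an integral `W'`, a dominant `π_W : W' → W`, an ideal sheaf `K'` and an OPEN IMMERSION `e' : W' → V'`
with `IsCleanPermissibleSeq p π_W (e^*J) μ K' (e^♯ G)`, `e' ≫ π = π_W ≫ e` and `K' = e'^*J'` (and `W'`, `V'` locally Noetherian).  Step: the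
centre `Y ⊆ V_i` restricts to `e_i⁻¹ Y ⊆ W_i`; if EMPTY, `W_i` maps to `V_{i+1}` through the blowing up (an isomorphism off `Y`,
✓ `IsBlowup.lift` / `isBlowup_id_top`) and nothing else changes (`controlledTransform_top`); if NON-EMPTY it is an irreducible open part of
`Y` — integral, regular (`isRegular_subscheme_comap_of_isOpenImmersion`), inside `{ord = μ}` (✓ `idealOrder_comap_of_etale`) and
clean-permissible (ascent ✓ `CleanPermissibleAt.functionFieldMap_of_isIso_stalkMap`) — and `W_{i+1} := Bl_{e_i⁻¹Y} W_i ↪ V_{i+1}` by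
✓ `IsBlowup.isPullback_of_isOpenImmersion`, transforms matching by ✓ `comap_controlledTransform_of_flat`.
[cite: GortzWedhorn2020, Prop. 13.91 (2)] [cite: Piltant2013, Prop. 5.1 (proof, Step 2)] -/
theorem IsCleanPermissibleSeq.exists_restrict_of_isOpenImmersion {p : ℕ} :
    ∀ {V' V : Scheme.{0}} [IsIntegral V'] [IsIntegral V] {π : V' ⟶ V} [IsDominant π] {J : V.IdealSheafData} {μ : ℕ}
      {J' : V'.IdealSheafData} {G : V.functionField}, IsCleanPermissibleSeq p π J μ J' G → IsLocallyNoetherian V →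
      ∀ {W : Scheme.{0}} [IsIntegral W] (e : W ⟶ V) [IsOpenImmersion e] [IsDominant e],
        ∃ (W' : Scheme.{0}) (_ : IsIntegral W') (πW : W' ⟶ W) (_ : IsDominant πW) (K' : W'.IdealSheafData) (e' : W' ⟶ V'),
          IsCleanPermissibleSeq p πW (J.comap e) μ K' (RatFn.functionFieldMap e G) ∧ IsOpenImmersion e' ∧
          e' ≫ π = πW ≫ e ∧ K' = J'.comap e' ∧ IsLocallyNoetherian W' ∧ IsLocallyNoetherian V' := by
  intro V' V _ _ π _ J μ J' G h
  induction h with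
  | nil J μ G =>
    intro hN W _ e _ _
    haveI : IsLocallyNoetherian W := LocallyOfFiniteType.isLocallyNoetherian e
    exact ⟨W, inferInstance, 𝟙 W, inferInstance, J.comap e, e, IsCleanPermissibleSeq.nil (J.comap e) μ _, inferInstance,
      by simp, rfl, inferInstance, hN⟩
  | @cons V₂ V₁ V _ _ _ τ _ π₁ _ J μ J₁ G Y hπ₁ hYint hYreg hY hτ hperm ih =>
    intro hN W _ e _ _
    obtain ⟨W₁, hW₁, πW, hπW, K₁, e₁, hseqW, he₁, hcomm₁, hK₁, hNW₁, hNV₁⟩ := ih hN e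
    haveI := hW₁
    haveI := hπW
    haveI := he₁
    haveI := hNW₁
    haveI := hNV₁
    haveI : IsDominant e₁ := isDominant_of_isOpenImmersion e₁
    -- the new stage `V₂` is locally Noetherian
    haveI : IsProper τ := hτ.isProper
    haveI : IsLocallyNoetherian V₂ := LocallyOfFiniteType.isLocallyNoetherian τ
    set C : V₁.IdealSheafData := vanishingIdeal Y with hCdef
    -- the restricted centre
    set YW : Closeds W₁ := Y.preimage e₁.continuous with hYWdef
    have hCW : C.comap e₁ = vanishingIdeal YW := comap_vanishingIdeal_of_isOpenImmersion e₁ Y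
    -- orders on `W₁` are orders on `V₁`
    have hordu : ∀ w : W₁, idealOrder K₁ w = idealOrder J₁ (e₁ w) := fun w => by
      rw [hK₁]; exact idealOrder_comap_of_etale e₁ J₁ w
    by_cases hne : ((YW : Closeds W₁) : Set W₁).Nonempty
    · -- NON-EMPTY restricted centre: blow it up
      have hirrW : IsIrreducible ((YW : Closeds W₁) : Set W₁) := by
        refine ⟨hne, ?_⟩
        rw [hYWdef, Closeds.coe_preimage]
        exact (isIrreducible_of_isIntegral_subscheme_vanishingIdeal Y hYint).isPreirreducible.preimage e₁.isOpenEmbedding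
      have hintW : IsIntegral (vanishingIdeal YW).subscheme := ComponentGluing.isIntegral_subscheme_vanishingIdeal YW hirrW
      have hregW : Scheme.IsRegular (vanishingIdeal YW).subscheme := by
        rw [← hCW]
        exact isRegular_subscheme_comap_of_isOpenImmersion e₁ C hYreg
      have hYWord : ∀ w ∈ ((YW : Closeds W₁) : Set W₁), idealOrder K₁ w = μ := by
        intro w hw
        rw [hordu]
        exact hY (e₁ w) hw
      have hCWbot : vanishingIdeal YW ≠ ⊥ := by
        intro hbot
        -- `YW = W₁`
        have hsupp : (((YW : Closeds W₁)) : Set W₁) = Set.univ := by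
          rw [← Scheme.IdealSheafData.coe_support_vanishingIdeal YW, hbot, Scheme.IdealSheafData.support_bot]
          rfl
        -- `Y ⊇ e₁(W₁)` is closed and dense, so `Y = V₁`
        have hYtop : Y = ⊤ := by
          apply SetLike.coe_injective
          have hsub : Set.range e₁ ⊆ (Y : Set V₁) := by
            rintro _ ⟨w, rfl⟩
            have hw : w ∈ ((YW : Closeds W₁) : Set W₁) := by rw [hsupp]; trivial
            exact hw
          have hdense : Dense (Set.range e₁) := e₁.isOpenEmbedding.isOpen_range.dense (Set.range_nonempty _)
          have huniv : (Y : Set V₁) = Set.univ :=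
            Set.eq_univ_of_univ_subset (by rw [← hdense.closure_eq]; exact closure_minimal hsub Y.isClosed)
          rw [huniv]
          rfl
        -- so `C = 0`, and `τ` would be a blowing up along `0` with non-empty (integral) source
        have hCbot : C = ⊥ := by rw [hCdef, hYtop, vanishingIdeal_top, Scheme.nilradical_eq_bot]
        have hE := hτ.isEffectiveCartier
        rw [hCbot, Scheme.IdealSheafData.comap_bot] at hE
        exact not_isEffectiveCartier_bot_of_isIntegral hE
      set τW := blowup.π (vanishingIdeal YW) with hτWdef
      have hτW : IsBlowup τW (vanishingIdeal YW) := blowup.isBlowup _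
      haveI : IsIntegral (blowup (vanishingIdeal YW)) := hτW.isIntegral hCWbot
      haveI : IsDominant τW := isDominant_of_isBlowup_of_ne_bot hτW hCWbot
      haveI : IsProper τW := hτW.isProper
      haveI : IsLocallyNoetherian (blowup (vanishingIdeal YW)) := LocallyOfFiniteType.isLocallyNoetherian τW
      -- clean-permissibility of the restricted centre (ascent along `e₁`)
      have hpermW : ∀ w ∈ ((YW : Closeds W₁) : Set W₁),
          CleanPermissibleAt p (algebraMap (W₁.presheaf.stalk w) W₁.functionField)
            (RatFn.functionFieldMap πW (RatFn.functionFieldMap e G)) (stalkIdeal (vanishingIdeal YW) w) := by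
        intro w hw
        haveI : IsIso (e₁.stalkMap w) := (IsOpenImmersion.iff_isIso_stalkMap.mp inferInstance).2 w
        have h1 := CleanPermissibleAt.functionFieldMap_of_isIso_stalkMap (p := p) e₁ w C (hperm (e₁ w) hw)
        rw [hCW, ← RingHom.comp_apply, ← RatFn.functionFieldMap_comp, Picover.FunctionFieldNormalizationIn.functionFieldMap_congr hcomm₁,
          RatFn.functionFieldMap_comp, RingHom.comp_apply] at h1
        exact h1
      have hstep : IsCleanPermissibleSeq p (τW ≫ πW) (J.comap e) μ (controlledTransform τW (vanishingIdeal YW) K₁ μ)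
          (RatFn.functionFieldMap e G) :=
        IsCleanPermissibleSeq.cons τW πW (J.comap e) μ K₁ (RatFn.functionFieldMap e G) YW hseqW hintW hregW hYWord hτW hpermW
      -- the open immersion `W₂ → V₂`
      have hτW' : IsBlowup τW (C.comap e₁) := by rw [hCW]; exact hτW
      let e₂ : blowup (vanishingIdeal YW) ⟶ V₂ := hτ.lift (τW ≫ e₁)
        (by rw [Scheme.IdealSheafData.comap_comp]; exact hτW'.isEffectiveCartier)
      have he₂τ : e₂ ≫ τ = τW ≫ e₁ := hτ.lift_comp _ _
      have hsq : IsPullback e₂ τW τ e₁ := hτ.isPullback_of_isOpenImmersion e₁ hτW' he₂τ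
      haveI : IsOpenImmersion e₂ := MorphismProperty.of_isPullback hsq.flip inferInstance
      haveI : IsLocallyNoetherian (blowup (vanishingIdeal YW)) := LocallyOfFiniteType.isLocallyNoetherian τW
      have hK₂ : controlledTransform τW (vanishingIdeal YW) K₁ μ = (controlledTransform τ C J₁ μ).comap e₂ := by
        rw [comap_controlledTransform_of_flat e₁ he₂τ C J₁ μ, hCW, hK₁]
      refine ⟨blowup (vanishingIdeal YW), inferInstance, τW ≫ πW, inferInstance, controlledTransform τW (vanishingIdeal YW) K₁ μ, e₂,
        hstep, inferInstance, ?_, hK₂, inferInstance, inferInstance⟩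
      rw [← Category.assoc, he₂τ, Category.assoc, hcomm₁, Category.assoc]
    · -- EMPTY restricted centre: lift `e₁` through the blowing up
      have hCWtop : C.comap e₁ = ⊤ := by
        rw [← Scheme.IdealSheafData.support_eq_bot_iff, hCW]
        ext w
        simp only [Scheme.IdealSheafData.coe_support_vanishingIdeal, Closeds.coe_bot, Set.mem_empty_iff_false, iff_false]
        exact fun hw => hne ⟨w, hw⟩
      let e₂ : W₁ ⟶ V₂ := hτ.lift e₁ (by rw [hCWtop]; exact isEffectiveCartier_top)
      have he₂τ : e₂ ≫ τ = 𝟙 W₁ ≫ e₁ := by rw [Category.id_comp]; exact hτ.lift_comp _ _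
      have hid : IsBlowup (𝟙 W₁) (C.comap e₁) := by rw [hCWtop]; exact isBlowup_id_top W₁
      have hsq : IsPullback e₂ (𝟙 W₁) τ e₁ := hτ.isPullback_of_isOpenImmersion e₁ hid he₂τ
      haveI : IsOpenImmersion e₂ := MorphismProperty.of_isPullback hsq.flip inferInstance
      have hK₂ : K₁ = (controlledTransform τ C J₁ μ).comap e₂ := by
        rw [comap_controlledTransform_of_flat e₁ he₂τ C J₁ μ, hCWtop, CampaignW46.controlledTransform_top,
          Scheme.IdealSheafData.comap_id, hK₁]
      refine ⟨W₁, inferInstance, πW, inferInstance, K₁, e₂, hseqW, inferInstance, ?_, hK₂, inferInstance, inferInstance⟩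
      rw [← Category.assoc, he₂τ, Category.id_comp, hcomm₁]

/-! ## The conclusion of X44c restricts to opens -/

/-- **The conclusion of X44c passes to open subschemes**: if `(J, μ)` on `V` is brought below order `μ` by a clean-permissible sequence for
the line of `G`, then so is `(e^*J, μ)` on `W` for the line of `e^♯ G`, for every open immersion `e : W → V` of integral schemes (orders are
read through `e'`, ✓ `idealOrder_comap_of_etale`).  Clean twin of ✓ `CampaignW46.OrderReducible.comap_of_etale` (open immersions only).
[cite: BierstoneGrigorievMilmanWlodarczyk2011, Lemma 8.0.3 (2)] [cite: GortzWedhorn2020, Prop. 13.91 (2)] -/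
theorem exists_isCleanPermissibleSeq_lt_of_isOpenImmersion {p : ℕ} {V W : Scheme.{0}} [IsIntegral V] [IsIntegral W]
    [IsLocallyNoetherian V] (e : W ⟶ V) [IsOpenImmersion e] [IsDominant e] {J : V.IdealSheafData} {μ : ℕ} {G : V.functionField}
    (h : ∃ (V' : Scheme.{0}) (π : V' ⟶ V) (_ : IsIntegral V') (_ : IsDominant π) (J' : V'.IdealSheafData),
      IsCleanPermissibleSeq p π J μ J' G ∧ ∀ x, idealOrder J' x < μ) :
    ∃ (W' : Scheme.{0}) (πW : W' ⟶ W) (_ : IsIntegral W') (_ : IsDominant πW) (K' : W'.IdealSheafData),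
      IsCleanPermissibleSeq p πW (J.comap e) μ K' (RatFn.functionFieldMap e G) ∧ ∀ w, idealOrder K' w < μ := by
  obtain ⟨V', π, hV', hπ, J', hseq, hlt⟩ := h
  haveI := hV'
  haveI := hπ
  obtain ⟨W', hW', πW, hπW, K', e', hseqW, he', -, hK', hNW', hNV'⟩ := hseq.exists_restrict_of_isOpenImmersion inferInstance e
  haveI := he'
  haveI := hNW'
  haveI := hNV'
  refine ⟨W', πW, hW', hπW, K', hseqW, fun w => ?_⟩
  rw [hK', idealOrder_comap_of_etale e' J' w]
  exact hlt (e' w)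

end Summit.ResolutionOfSingularities.ResolutionOfSingularities.Theorems.RadicialJung.CleanModels

end
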